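import Summits.CriticalPhenomena.CardyFormulaZ2.Theses.CardyExpCovariance
import Literature.Probability.Percolation.InterfaceScalingLimitDiscretised
import Literature.Probability.Percolation.BoxCrossingJordan
import Literature.Probability.RandomPlanarGeometry.ChordalCurveFamily
import Literature.Probability.RandomPlanarGeometry.SLESixCrossingNondegenerate
import Literature.Probability.RandomPlanarGeometry.CritPercSLELocalityProofs
import Literature.Probability.RandomPlanarGeometry.CritPercSLELocalityItoProofs
import Literature.Probability.RandomPlanarGeometry.CritPercSLESimplePathHolds
import Literature.Probability.RandomPlanarGeometry.ConformalMapCaratheodoryProofs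
import Literature.Probability.RandomPlanarGeometry.SLETargetIndependenceSix
import Literature.Probability.RandomPlanarGeometry.SLEExistenceNeEightHolds

/-!
# `CardyRigiditySeq` from its three pieces — the glue of the split of stmt-CriticalPhenomena-4680

Route `CardyExpCovariance` (sub-problem `CardyFormulaZ2`), crux `CardyRigiditySeq` (rank 3):

    ∀ u f, u_k → 0⁺ → (∀ R φ x, R.IsUniformizing φ x → P_{1/2}(R, u_k) → f (crossRatio x)) →
      EqOn f cardyFunction (Ioo 0 1)

"if along ONE sequence of meshes the bond-ℤ² crossing probabilities of every conformal rectangle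
converge to a kernel `f` of the cross-ratio, then `f` is Cardy's function".  This file PROVES the
assembly of the typed decomposition filed by the crux strategist (BC2 redirect of the re-audit,
2026-08-17): with

* `HYPSEQ u f` := the hypothesis above (a sequential conformally invariant crossing kernel), and
* `LIMSEQ κ u` := for every Dobrushin domain `D` and every admissible ℤ²-discretisation family `E`
  of `D`, the medial exploration interface `bondInterfaceIn D (E (u k))` of `P_{1/2}` converges in
  law ALONG THE SEQUENCE `u` (portmanteau form: all bounded continuous test functions on
  `CurveClass ℂ`) to a chordal SLE_κ random curve in `D`,

the three pieces (the route's new crux leaves; statements inlined verbatim below, in this order) are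

1. `SeqKernelForcesSLE`      : `HYPSEQ u f → ∃ κ > 0, LIMSEQ κ u` (Camia–Newman / Smirnov Thm 2
   machine run with an UNKNOWN kernel along one sequence; Schramm's principle);
2. `SeqCrossingReadout`      : `0 < κ → HYPSEQ u f → LIMSEQ κ u →` every SLE_κ law `μ` of
   `(Ω; a, c)` has `μ[hits (cd) before (bc)] = f (crossRatio x)` (the crossing event is a
   continuity set of the limit; both numbers are limits of `P_{1/2}(R, u_k)`);
3. `SeqLimitTargetIndependent` : `0 < κ → LIMSEQ κ u →` some family of SLE_κ laws is
   `ChordalFamily.IsTargetIndependent` (lattice locality, splitting form, passes to the limit);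

and the theorem `CardyRigiditySeq_of_subs : (1) → (2) → (3) → CardyRigiditySeq` is proved here
WITHOUT `sorry`, consuming the tree's theorems: `κ > 4` because for `κ ≤ 4` piece 2 and the
Rohde–Schramm simple phase (`measureReal_hitsBefore_eq_zero_of_le_four`, fed with
`ae_isSimpleTrace_sleTrace_of_le_four_holds` and Carathéodory
`JordanDomain.exists_continuousOn_extension_holds`) would give `f = 0` at the modulus of the
unit-disc rectangle, whereas the crossing probabilities of that rectangle tend to `f` there ALONG
`u`, making `0` a cluster point of them along `𝓝[>] 0` (`MapClusterPt.of_comp`) — impossible by RSW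
(`discreteCrossingProb_clusterPt_mem_Ioo_holds`); then `κ = 6` by the proved Lawler–Schramm–Werner
characterisation `eq_six_of_isSLELaw_of_isTargetIndependent_of_four_lt` (read at the unit disc with
three marks); every `η ∈ (0,1)` is the modulus of a Carleson triangle carrying an SLE₆ law
(`exists_isSLELaw_cardyFunction_crossRatio_eq_at`, `exists_isSLECurve_six`, injectivity of `F`:
`strictMonoOn_cardyFunction_holds`, `cardyFunction_mem_Ioo`), where piece 2 evaluates `f η` as the
SLE₆ crossing probability, which is `F η` (`sle_six_measureReal_hitsBefore_holds`, Cardy's formula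
for SLE₆, proved in the tree).  Sequential twin of the registered line
`Cruxes/CardyRigidity/Lines/kappa_free_splitting.lean` of the full-filter sibling crux
`CardyRigidity` (stmt-CriticalPhenomena-0746).

Negatives honoured: stmt-CriticalPhenomena-0698 (`not_SymmetryUpgrade`: an ABSTRACT local-Markov
chordal family need not be SLE₆) is not instantiated — every hypothesis speaks about laws that are
genuine sequential scaling limits of the bond-ℤ² interface; stmt-0748 (`NegDegenerateArcs` refuted)
is used positively (RSW keeps cluster points in `(0,1)`).
-/

open scoped NNReal Topology
open MeasureTheory Filter Set
open UpperHalfPlane (upperHalfPlaneSet)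
open Literature.Probability.RandomPlanarGeometry Literature.Probability.LatticeModels
open Literature.Probability.Percolation hiding cardyFunction

namespace Summit.CriticalPhenomena.CardyFormulaZ2.Cruxes.CardyRigiditySeq.SplitGlue

/-- **`CardyRigiditySeq` from its three pieces** (`SeqKernelForcesSLE → SeqCrossingReadout →
SeqLimitTargetIndependent → CardyRigiditySeq`, statements inlined verbatim in this order; see the
module docstring for the proof).  Glue theorem of the split of stmt-CriticalPhenomena-4680 on route
`CardyExpCovariance`. -/
theorem CardyRigiditySeq_of_subs :
    (∀ (u : ℕ → ℝ) (f : ℝ → ℝ), Filter.Tendsto u Filter.atTop (nhdsWithin 0 (Set.Ioi 0)) → (∀ (R : Literature.Probability.RandomPlanarGeometry.ConformalRectangle) (φ : Literature.Probability.RandomPlanarGeometry.ConformalEquiv UpperHalfPlane.upperHalfPlaneSet R.carrier) (x : Fin 4 → ℝ), R.IsUniformizing φ x → Filter.Tendsto (fun k ↦ Literature.Probability.Percolation.bondDomainCrossingProb R (u k)) Filter.atTop (nhds (f (Literature.Probability.RandomPlanarGeometry.crossRatio x)))) → ∃ κ : NNReal, 0 < κ ∧ ∀ (D : Literature.Probability.RandomPlanarGeometry.DobrushinDomain)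 (E : ℝ → Literature.Probability.LatticeModels.DiscreteDobrushin), Literature.Probability.LatticeModels.ZdDiscretisationFamily D E → ∃ Γ : (NNReal → ℝ) → Literature.Probability.RandomPlanarGeometry.CurveClass ℂ, Literature.Probability.RandomPlanarGeometry.IsSLECurve κ D Γ ∧ ∀ g : BoundedContinuousFunction (Literature.Probability.RandomPlanarGeometry.CurveClass ℂ) ℝ, Filter.Tendsto (fun k ↦ ∫ ω, g (Literature.Probability.Percolation.bondInterfaceIn D (E (u k)) ω) ∂(Literature.Probability.Percolation.bondPercolation (Literature.Probability.LatticeModels.zdGraph 2) Literature.Probability.Percolation.half)) Filter.atTop (nhds (∫ ω, g (Γ ω) ∂Literature.Probability.Process.preWienerMeasure))) →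
    (∀ (u : ℕ → ℝ) (f : ℝ → ℝ) (κ : NNReal), 0 < κ → Filter.Tendsto u Filter.atTop (nhdsWithin 0 (Set.Ioi 0)) → (∀ (R : Literature.Probability.RandomPlanarGeometry.ConformalRectangle) (φ : Literature.Probability.RandomPlanarGeometry.ConformalEquiv UpperHalfPlane.upperHalfPlaneSet R.carrier) (x : Fin 4 → ℝ), R.IsUniformizing φ x → Filter.Tendsto (fun k ↦ Literature.Probability.Percolation.bondDomainCrossingProb R (u k)) Filter.atTop (nhds (f (Literature.Probability.RandomPlanarGeometry.crossRatio x)))) → (∀ (D : Literature.Probability.RandomPlanarGeometry.DobrushinDomain) (E : ℝ → Literature.Probability.LatticeModels.DiscreteDobrushin), Literature.Probability.LatticeModels.ZdDiscretisationFamily D E → ∃ Γ : (NNReal → ℝ) → Literature.Probability.RandomPlanarGeometry.CurveClass ℂ, Literature.Probability.RandomPlanarGeometry.IsSLECurve κ D Γ ∧ ∀ g : BoundedContinuousFunction (Literature.Probability.RandomPlanarGeometry.CurveClass ℂ) ℝ, Filter.Tendsto (fun k ↦ ∫ ω, g (Literature.Probability.Percolation.bondInterfaceIn D (E (u k)) ω)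 ∂(Literature.Probability.Percolation.bondPercolation (Literature.Probability.LatticeModels.zdGraph 2) Literature.Probability.Percolation.half)) Filter.atTop (nhds (∫ ω, g (Γ ω) ∂Literature.Probability.Process.preWienerMeasure))) → ∀ (R : Literature.Probability.RandomPlanarGeometry.ConformalRectangle) (μ : MeasureTheory.Measure (Literature.Probability.RandomPlanarGeometry.CurveClass ℂ)) (φ : Literature.Probability.RandomPlanarGeometry.ConformalEquiv UpperHalfPlane.upperHalfPlaneSet R.carrier) (x : Fin 4 → ℝ), Literature.Probability.RandomPlanarGeometry.IsSLELaw κ (R.chord 0 2 (by decide)) μ → R.IsUniformizing φ x → μ.real (Literature.Probability.RandomPlanarGeometry.CurveClass.hitsBefore (R.arc 2) (R.arc 1)) = f (Literature.Probability.RandomPlanarGeometry.crossRatio x)) →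
    (∀ (u : ℕ → ℝ) (κ : NNReal), 0 < κ → Filter.Tendsto u Filter.atTop (nhdsWithin 0 (Set.Ioi 0)) → (∀ (D : Literature.Probability.RandomPlanarGeometry.DobrushinDomain) (E : ℝ → Literature.Probability.LatticeModels.DiscreteDobrushin), Literature.Probability.LatticeModels.ZdDiscretisationFamily D E → ∃ Γ : (NNReal → ℝ) → Literature.Probability.RandomPlanarGeometry.CurveClass ℂ, Literature.Probability.RandomPlanarGeometry.IsSLECurve κ D Γ ∧ ∀ g : BoundedContinuousFunction (Literature.Probability.RandomPlanarGeometry.CurveClass ℂ) ℝ, Filter.Tendsto (fun k ↦ ∫ ω, g (Literature.Probability.Percolation.bondInterfaceIn D (E (u k)) ω) ∂(Literature.Probability.Percolation.bondPercolation (Literature.Probability.LatticeModels.zdGraph 2) Literature.Probability.Percolation.half)) Filter.atTop (nhds (∫ ω, g (Γ ω) ∂Literature.Probability.Process.preWienerMeasure))) → ∃ Q : Literature.Probability.RandomPlanarGeometry.ChordalFamily, (∀ D : Literature.Probability.RandomPlanarGeometry.DobrushinDomain, Literature.Probability.RandomPlanarGeometry.IsSLELaw κ D (Q D)) ∧ Q.IsTargetIndependent)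 →
    Summit.CriticalPhenomena.CardyFormulaZ2.Theses.CardyExpCovariance.CardyRigiditySeq := by
  intro hA hB hC u f hu hf η hη
  -- X₁: along `u` the interfaces converge to SLE_κ for one κ > 0
  obtain ⟨κ, hκ, hlim⟩ := hA u f hu hf
  -- X₃: a target-independent family of SLE_κ laws
  obtain ⟨Q, hQ, hT⟩ := hC u κ hκ hu hlim
  -- κ > 4 (Rohde–Schramm simple phase versus RSW non-degeneracy along the sequence `u`)
  have h4 : 4 < κ := by
    refine lt_of_not_ge fun hle ↦ ?_
    set R₀ : ConformalRectangle := ConformalRectangle.unitDisc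
    obtain ⟨φ₀, x₀, hφ₀⟩ := MarkedDomain.exists_isUniformizing_holds R₀
    have hμ₀ : IsSLELaw κ (R₀.chord 0 2 (by decide)) (Q (R₀.chord 0 2 (by decide))) := hQ _
    have hzero :
        (Q (R₀.chord 0 2 (by decide))).real (CurveClass.hitsBefore (R₀.arc 2) (R₀.arc 1)) = 0 :=
      measureReal_hitsBefore_eq_zero_of_le_four
        (fun κ ↦ ae_isSimpleTrace_sleTrace_of_le_four_holds (κ := κ))
        JordanDomain.exists_continuousOn_extension_holds hκ hle R₀ hμ₀
    have hker₀ := hB u f κ hκ hu hf hlim R₀ _ φ₀ x₀ hμ₀ hφ₀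
    have hf0 : f (crossRatio x₀) = 0 := hker₀.symm.trans hzero
    -- along `u` the crossing probabilities of `R₀` tend to `f (crossRatio x₀) = 0` …
    have htend : Tendsto (fun k ↦ bondDomainCrossingProb R₀ (u k)) atTop (𝓝 0) := by
      simpa only [hf0] using hf R₀ φ₀ x₀ hφ₀
    -- … so `0` is a cluster point of them along `𝓝[>] 0`, contradicting RSW
    have hseq : MapClusterPt (0 : ℝ) atTop
        ((fun δ ↦ discreteCrossingProb half R₀.carrier δ (R₀.arc 0) (R₀.arc 2)) ∘ u) :=
      htend.mapClusterPt
    have hclu : MapClusterPt (0 : ℝ) (𝓝[>] (0 : ℝ))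
        (fun δ ↦ discreteCrossingProb half R₀.carrier δ (R₀.arc 0) (R₀.arc 2)) :=
      hseq.of_comp hu
    exact (lt_irrefl (0 : ℝ)) (discreteCrossingProb_clusterPt_mem_Ioo_holds R₀ hclu).1
  -- Lawler–Schramm–Werner: a target-independent family of SLE_κ laws with κ > 4 has κ = 6
  have h6 : κ = 6 :=
    eq_six_of_isSLELaw_of_isTargetIndependent_of_four_lt h4 hQ hT
      (ConformalRectangle.unitDisc.restrictMarks (Fin.castSuccOrderEmb (n := 3)))
  subst h6
  -- realise `η` as the modulus of a rectangle carrying an SLE₆ law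
  have hs : cardyFunction η ∈ Ioo (0 : ℝ) 1 := cardyFunction_mem_Ioo hη
  obtain ⟨R, μ, φ, x, hμ, hφ, hval⟩ :=
    exists_isSLELaw_cardyFunction_crossRatio_eq_at (κ := 6) exists_isSLECurve_six hs
  have hx : crossRatio x ∈ Ioo (0 : ℝ) 1 :=
    ConformalRectangle.crossRatio_mem_Ioo_of_isUniformizing hφ
  have hmono : StrictMonoOn cardyFunction (Icc 0 1) := strictMonoOn_cardyFunction_holds
  have hxη : crossRatio x = η :=
    hmono.injOn ⟨hx.1.le, hx.2.le⟩ ⟨hη.1.le, hη.2.le⟩ hval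
  -- X₂ at κ = 6: `f (crossRatio x)` is the SLE₆ crossing probability, `= F (crossRatio x)`
  have hker : μ.real (CurveClass.hitsBefore (R.arc 2) (R.arc 1)) = f (crossRatio x) :=
    hB u f 6 hκ hu hf hlim R μ φ x hμ hφ
  have hcardy : μ.real (CurveClass.hitsBefore (R.arc 2) (R.arc 1)) = cardyFunction (crossRatio x) :=
    sle_six_measureReal_hitsBefore_holds R hμ hφ
  rw [← hxη, ← hker, hcardy]


end Summit.CriticalPhenomena.CardyFormulaZ2.Cruxes.CardyRigiditySeq.SplitGlue
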